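import Literature.MathematicalPhysics.QuantumFieldTheory.Balaban1983to89.Node00.CarriersB8SubBP2C
import Literature.MathematicalPhysics.QuantumFieldTheory.Balaban1983to89.B8LeafOfRecordSubBPCutPFields8

/-!
# `Balaban1983to89.B8LeafOfRecordSubBP2CCutPFields7` — THE «P₂C» SLOT `Node00.B8LeafOfRecordSubBP₂C` AT THE PRINT-CLASS CUT LAYER `λ.cutSubBP J lan c₁ ρ₀`:
# its reading, FULL cut ⇒ PRINT-CLASS cut (same ∕ changed threshold), ★★★ the slot's CONSTRUCTOR FROM SEVEN BINDERS — [Balaban1985RegularSpaces] PROPOSITION 6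
# (p. 99) SUPPLIED by p596570 AND PROPOSITION 7 (p. 100) SUPPLIED by the pin — and ★★★ the by-name road for the δ₂ knits (`θ.D ≥ 2`, `θ.L ≥ 5`)

statement-level skeleton of published theorems with citation tags; proofs where landed; nothing here is a claim about the
Yang–Mills mass gap

PDF held: `paper:balaban1985-cmp99-regular-spaces-gauge-fixing`; Prop. 6 p. 99 ((1.135)–(1.138)), p. 98 (the cubes of Prop. 6), Prop. 7 (1.143)–(1.145) p. 100,
Lemma 1 p. 79, Thm 2 p. 83, Prop. 3 p. 87, Thm 4 p. 88, Prop. 5 p. 94, Thm 8 (1.146) p. 101 (the seven displayed binders).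

CITATION HEADER (lean-in-tree rule).  Cell `pub-ymgap` (HUMAN RULING D-0062, Track A), DAG node N05 = [B8], seat `pub-ymgap-dag-n05-e` g11 (R141 (C) row s3b —
Proposition 6's cube road; the «P₂C» twin announced in ACK-4, bus 2026-08-28 03:12Z, on dag-n05-d's DESIGN «P₂C» and dag-n05-w1's pin).  WHY THIS FILE.  NODE 00's
re-pin «P₂C» (dag-n05-w1 `Node00/CarriersB8SubBP2C`: admissible sub-index `IdxB8SubC θ = {j : IdxB8SubB θ ∕∕ DomainSeq θ.L j.1.1.Ω}`, δ₂-members `famB8OfRecordSubBP₂C`,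
leaf shape `B8LeafKnitRSC.B8LeafRSC` with Proposition 7 in the `Prop7RepairedC (c₇OfRecord θ)` currency and print's axial map PINNED) keeps the residual layer's
Proposition-6 carriers `λ.cub : λ.I8d → CubeData` FREE and slot-independent — so this seat's print-class cut layer `λ.cutSubBP J lan c₁ ρ₀` (p598169:
`cub := fun j : IdxB8SubB θ => zdCubP θ.𝔸 θ.L ρ₀ j.1.1`) serves the new slot UNCHANGED, and the family-level Proposition 6 `B8Prop6PrintedZdCubPGamma.p6_residB8_of_zdCubP`
(p596570, unconditional for `θ.D ≥ 2`, odd `θ.L ≥ 5`) supplies its `p6` conjunct exactly as at the P-slot (p598699 ∕ dag-n05-d D9d p599197).  The pin supplies `p7`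
itself (`prop7_famB8OfRecordSubBP₂C`; its constructors `b8LeafOfRecordSubBP₂C_of_fields` ∕ `…_cutSubB_of_fields` take EIGHT conjuncts, `p6` among them).  THIS FILE
is the token image of `B8LeafOfRecordSubBPCutPFields8` at the «P₂C» slot: §1 the reading of the slot at the print-class cut (`Iff.rfl` + conjunct by conjunct), ★ FULL
cut ⇒ PRINT-CLASS cut at every `ρ₀` and ★ with THRESHOLD CHANGE; §2 ★★★ `b8LeafOfRecordSubBP₂C_cutSubBP_of_fields7` — the slot at the print-class cut from SEVEN binders
`l1 t2 p3 t4 p5e p5u t8` (`p6` by p596570, `p7` by the pin), `…_dvd`; ★★★ `b8LeafOfRecordSubBP₂C_cutSubBP_of_cutSubB_any` — THE BY-NAME ROAD for dag-n05-d's δ₂ knits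
(D9b₂C ∕ D9c₂C at ANY source threshold, at `c₁ := 0` with their `p6` binder FREE by `B8LeafOfRecordSubBPCutPFields8.prop6Printed_cubB8OfRecord_subB_of_nonpos`) ⇒ the
slot at `λ.cutSubBP J lan c₁⋆ ρ₀` with the GENUINE threshold `0 < c₁⋆`.  A6: the Prop-6 conjunct at the cut is not vacuous family-wide —
`B8LeafOfRecordSubBPCutPFields8.exists_member_printCube_cutSubBP` (same layer, by name).  Kind «kernel-checked proof»; theorems only, no `def`.

HONEST SCOPE ∕ A6.  By-name bookkeeping + ONE application of p596570; the analytic content of `p6` is dag-n05-c's transplant T4 + this seat's flat line γ (Fγ1–Fγ11);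
of `p7`, dag-n05-c ∕ n05-w1 ∕ n05-w2's tower-axial chain at `c₇OfRecord θ = 530·θ.D·θ.L²` (a WEAKER currency than print's `2α₂` — ref-A WATCH-P7-CURRENCY-RECORD, the
planners' statement-of-record decision, displayed in the pin).  The SEVEN remaining binders are DISPLAYED hypotheses (Lemma 1 kernel instance exists; Thm 2 ∕ Prop 3 ∕
Thm 4 ∕ Thm 8 = the δ₂ chain modulo [Balaban1985BackgroundPropagators]-type sockets = N06 content; Prop. 5 ∃ ∕ ! at `lan`, served at `zdLan`) — NOT claimed here.
The dials `B₁⋆ ≤ λ.B₁`, `c₁ ≤ c₁⋆` are print's «there exist constants B₁, …, c₁».  Which layer the record's ∃-currency names is NODE 00's ∕ the planners' ∕ dag-n05-d's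
call.  N05 NOT discharged by this file; count-neutral until a referee's act-(iv) read and the chair's word; one finite `𝕋⁴` programme at fixed `ε`, Bałaban as printed;
nothing continuum ∕ ℝ⁴ ∕ OS ∕ mass-gap ∕ Clay.  No `sorry`, no `def`, no `instance`, no `notation`; standard axioms.  Unit `pub-ymgap-dag-n05-e` (g11), 2026-08-28.
-/

noncomputable section

namespace Literature.MathematicalPhysics.QuantumFieldTheory.Balaban1983to89.B8LeafOfRecordSubBP2CCutPFields7

open DagBinding
open B8LeafKnitRSC (B8LeafRSC)
open B8LeafModelZd (ZdIdx)
open B8LeafModelZd3P2 (zdGF3P₂ zdGF3HP₂)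
open B8Lemma1NonAbelian (blockPairNA)
open B8IdxB8LawsB (IdxB8LawsB IdxB8SubB)
open B8Prop7TowerAxialRecord (toAxialTowerResid)
open B8Prop6PrintedZdCubPGamma (p6_residB8_of_zdCubP)
open B8LeafOfRecordSubBPCutPFields8 (prop6Printed_cubB8OfRecord_subB_of_nonpos)
open Node00 (Stage3Params ResidB8 zdCubP cubB8OfRecord IdxB8SubC c₇OfRecord famB8OfRecordSubBP₂C B8LeafOfRecordSubBP₂C
  b8LeafOfRecordSubBP₂C_iff_classFree_and_P₂C b8LeafOfRecordSubBP₂C_cutSubB_iff_classFree_and_P₂C b8LeafOfRecordSubBP₂C_of_fields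
  prop6Printed_zdCubP_of_zdCub)

/-! ## §1  The reading of the «P₂C» slot at the print-class cut layer; FULL cut ⇒ PRINT-CLASS cut -/

section ReadingP₂C

variable {θ : Stage3Params}

/-- **THE «P₂C» SLOT AT THE PRINT-CLASS CUT LAYER READS** (`Iff.rfl`): `B8LeafOfRecordSubBP₂C θ (λ.cutSubBP J lan c₁ ρ₀)` is the `B8LeafRSC` leaf at `c₇OfRecord θ`
over `famB8OfRecordSubBP₂C θ λ.β λ.len`, Prop. 5 at `lan`, Prop. 6 at `fun j : IdxB8SubB θ => zdCubP θ.𝔸 θ.L ρ₀ j.1.1`, print's axial map, threshold `c₁` (the cut touches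
neither `β, len` nor the pinned map). [cite: Balaban1985RegularSpaces, Lemma 1 – Thm 8 pp.79–101 (bookkeeping)] -/
theorem b8LeafOfRecordSubBP₂C_cutSubBP_iff (lam : ResidB8 θ) (J : Type) (lan : J → B8.LandauData) (c₁ : ℝ) (ρ₀ : ℕ) :
    B8LeafOfRecordSubBP₂C θ (lam.cutSubBP J lan c₁ ρ₀) ↔
      B8LeafRSC θ.D (θ.L : ℝ) lam.C₂ lam.B₁' lam.inp.B₀' lam.B₁ lam.B₂ c₁ lam.inp lam.B₀β (c₇OfRecord θ) (blockPairNA θ.D θ.L θ.𝔸)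
        (fun j : IdxB8SubC θ => famB8OfRecordSubBP₂C θ lam.β lam.len j) lan (fun j : IdxB8SubB θ => zdCubP θ.𝔸 θ.L ρ₀ j.1.1)
        (fun j => toAxialTowerResid θ lam.β lam.len j.1.1) :=
  Iff.rfl

/-- **THE «P₂C» SLOT AT THE PRINT-CLASS CUT LAYER, READ CONJUNCT BY CONJUNCT** (the pin's `b8LeafOfRecordSubBP₂C_iff_classFree_and_P₂C` at `λ.cutSubBP J lan c₁ ρ₀`):
Lemma 1, Prop. 5 ∃ ∕ ! at `lan`, PROPOSITION 6 ON PRINT'S CLASS `B8.Prop6Printed θ.D θ.L λ.B₁ c₁ (fun j => zdCubP θ.𝔸 θ.L ρ₀ j.1.1)` ∧ Thm 2 ∕ Prop 3 ∕ Thm 4 at the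
δ₂-members, Prop 7 in the repaired currency for print's map, Thm 8 surviving, over the admissible sub-index.
[cite: Balaban1985RegularSpaces, Lemma 1 p.79, Thm 2 p.83, Prop. 3 p.87, Thm 4 p.88, Prop. 5 p.94, Prop. 6 p.99, Prop. 7 p.100, Thm 8 (1.146) p.101] -/
theorem b8LeafOfRecordSubBP₂C_cutSubBP_iff_classFree_and_P₂C (lam : ResidB8 θ) (J : Type) (lan : J → B8.LandauData) (c₁ : ℝ) (ρ₀ : ℕ) :
    B8LeafOfRecordSubBP₂C θ (lam.cutSubBP J lan c₁ ρ₀) ↔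
      (B8.Lemma1Printed θ.D (blockPairNA θ.D θ.L θ.𝔸) ∧
        B8.Prop5Exists lam.inp.B₀' lam.B₁ lan ∧ B8.Prop5Unique lan ∧
        B8.Prop6Printed θ.D (θ.L : ℝ) lam.B₁ c₁ (fun j : IdxB8SubB θ => zdCubP θ.𝔸 θ.L ρ₀ j.1.1)) ∧
      (B8.Thm2Printed (fun j : IdxB8SubC θ => (zdGF3P₂ θ.𝔸 θ.L lam.β lam.len j.1.1.1).toGFData) ∧
        B8.Prop3Printed θ.D (θ.L : ℝ) lam.C₂ lam.inp lam.B₀β (fun j : IdxB8SubC θ => (zdGF3P₂ θ.𝔸 θ.L lam.β lam.len j.1.1.1).toGFData2) ∧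
        B8.Thm4Printed lam.B₁' (fun j : IdxB8SubC θ => (zdGF3P₂ θ.𝔸 θ.L lam.β lam.len j.1.1.1).toGFData) ∧
        B8Ineq145.Prop7RepairedC (c₇OfRecord θ) (fun j : IdxB8SubC θ => famB8OfRecordSubBP₂C θ lam.β lam.len j)
          (fun j => toAxialTowerResid θ lam.β lam.len j.1.1) ∧
        B8Thm8Surviving.Thm8SurvivingAt 1 lam.B₁ lam.B₂ (fun j : IdxB8SubC θ => famB8OfRecordSubBP₂C θ lam.β lam.len j)) :=
  b8LeafOfRecordSubBP₂C_iff_classFree_and_P₂C (lam.cutSubBP J lan c₁ ρ₀)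

/-- ★ **THE «P₂C» SLOT AT dag-n05-d's CUT IMPLIES IT AT THE PRINT-CLASS CUT, AT EVERY `ρ₀`** — the `p6` conjunct passes FULL ⇒ CUT (k0-s2-w2's
`prop6Printed_zdCubP_of_zdCub` at `f := (·.1.1)`), the other eight conjuncts are IDENTICAL; never conversely.
[cite: Balaban1985RegularSpaces, Prop. 6 p.99, p.98 (bookkeeping)] -/
theorem b8LeafOfRecordSubBP₂C_cutSubBP_of_cutSubB (lam : ResidB8 θ) (J : Type) (lan : J → B8.LandauData) (c₁ : ℝ) (ρ₀ : ℕ)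
    (h : B8LeafOfRecordSubBP₂C θ (lam.cutSubB J lan c₁)) : B8LeafOfRecordSubBP₂C θ (lam.cutSubBP J lan c₁ ρ₀) := by
  obtain ⟨⟨h1, h5e, h5u, h6⟩, hP⟩ := (b8LeafOfRecordSubBP₂C_cutSubB_iff_classFree_and_P₂C lam J lan c₁).1 h
  exact (b8LeafOfRecordSubBP₂C_cutSubBP_iff_classFree_and_P₂C lam J lan c₁ ρ₀).2
    ⟨⟨h1, h5e, h5u, prop6Printed_zdCubP_of_zdCub (fun j : IdxB8SubB θ => j.1.1) ρ₀ h6⟩, hP⟩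

/-- ★ **THE «P₂C» SLOT AT dag-n05-d's CUT WITH THRESHOLD `c₁`, PLUS PROPOSITION 6 ON PRINT'S CLASS WITH THRESHOLD `c₁′`, GIVE THE SLOT AT THE PRINT-CLASS CUT WITH
THRESHOLD `c₁′`** — the transfer WITH THRESHOLD CHANGE (k0-s2-w2 g3's device; the eight non-Prop-6 conjuncts do not read the threshold).  With `c₁ := 0` the source slot
needs NO genuine Proposition-6 input (`B8LeafOfRecordSubBPCutPFields8.prop6Printed_cubB8OfRecord_subB_of_nonpos`).
[cite: Balaban1985RegularSpaces, Prop. 6 p.99, Thm 2 p.83 («There exist constants B₁, B₂(β₀), c₁») (bookkeeping)] -/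
theorem b8LeafOfRecordSubBP₂C_cutSubBP_of_cutSubB' (lam : ResidB8 θ) (J : Type) (lan : J → B8.LandauData) {c₁ c₁' : ℝ} (ρ₀ : ℕ)
    (h : B8LeafOfRecordSubBP₂C θ (lam.cutSubB J lan c₁))
    (p6 : B8.Prop6Printed θ.D (θ.L : ℝ) lam.B₁ c₁' (fun j : IdxB8SubB θ => zdCubP θ.𝔸 θ.L ρ₀ j.1.1)) :
    B8LeafOfRecordSubBP₂C θ (lam.cutSubBP J lan c₁' ρ₀) := by
  obtain ⟨⟨h1, h5e, h5u, -⟩, hP⟩ := (b8LeafOfRecordSubBP₂C_cutSubB_iff_classFree_and_P₂C lam J lan c₁).1 h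
  exact (b8LeafOfRecordSubBP₂C_cutSubBP_iff_classFree_and_P₂C lam J lan c₁' ρ₀).2 ⟨⟨h1, h5e, h5u, p6⟩, hP⟩

end ReadingP₂C

/-! ## §2  ★★★ The constructor of the «P₂C» slot at the print-class cut WITH PROPOSITIONS 6 AND 7 SUPPLIED (seven binders), and the by-name road -/

section Fields7

variable (θ : Stage3Params)

/-- ★★★ **CONSTRUCTOR OF THE «P₂C» SLOT AT THE PRINT-CLASS CUT LAYER FROM SEVEN CONJUNCTS — PROPOSITION 6 SUPPLIED (p596570), PROPOSITION 7 SUPPLIED (the pin)**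
(`θ.D ≥ 2`, `θ.L ≥ 5`; `θ.L` odd by `θ.hL`).  There are a big-block size `ρ₀ ≥ 1` (print's `R₁M₁`) and constants `B₁⋆ > 0`, `c₁⋆ > 0` — functions of `θ.D, θ.L` — such
that for EVERY residual layer `λ` with `B₁⋆ ≤ λ.B₁`, every Prop.-5 carrier family `lan : J → LandauData` and every threshold `c₁ ≤ c₁⋆`: Lemma 1, Thm 2 ∕ Prop 3 ∕ Thm 4 at
the δ₂-members, Prop. 5 ∃ ∕ ! at `lan`, Thm 8 surviving at the δ₂-members (the pin's `b8LeafOfRecordSubBP₂C_of_fields` binders `l1 t2 p3 t4 p5e p5u t8` at this layer, letter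
for letter) give `B8LeafOfRecordSubBP₂C θ (λ.cutSubBP J lan c₁ ρ₀)`.  `p6` is SUPPLIED by `B8Prop6PrintedZdCubPGamma.p6_residB8_of_zdCubP` ([B8] Proposition 6 as printed on
print's p. 98 class, unconditional), `p7` by the pin's `prop7_famB8OfRecordSubBP₂C` (inside `…_of_fields`).
[cite: Balaban1985RegularSpaces, Prop. 6 (1.135)–(1.138) p.99, p.98, Prop. 7 (1.144)–(1.145) p.100; Lemma 1 p.79, Thm 2 p.83, Prop. 3 p.87, Thm 4 p.88, Prop. 5 p.94, Thm 8 (1.146) p.101 (the seven displayed binders)] -/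
theorem b8LeafOfRecordSubBP₂C_cutSubBP_of_fields7 (hD : 2 ≤ θ.D) (hL5 : 5 ≤ θ.L) :
    ∃ ρ₀ : ℕ, ∃ B₁ c₁' : ℝ, 1 ≤ ρ₀ ∧ 0 < B₁ ∧ 0 < c₁' ∧
      ∀ (lam : ResidB8 θ) (J : Type) (lan : J → B8.LandauData) (c₁ : ℝ), B₁ ≤ lam.B₁ → c₁ ≤ c₁' →
        B8.Lemma1Printed θ.D (blockPairNA θ.D θ.L θ.𝔸) →
        B8.Thm2Printed (fun j : IdxB8SubC θ => (zdGF3P₂ θ.𝔸 θ.L lam.β lam.len j.1.1.1).toGFData) →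
        B8.Prop3Printed θ.D (θ.L : ℝ) lam.C₂ lam.inp lam.B₀β (fun j : IdxB8SubC θ => (zdGF3P₂ θ.𝔸 θ.L lam.β lam.len j.1.1.1).toGFData2) →
        B8.Thm4Printed lam.B₁' (fun j : IdxB8SubC θ => (zdGF3P₂ θ.𝔸 θ.L lam.β lam.len j.1.1.1).toGFData) →
        B8.Prop5Exists lam.inp.B₀' lam.B₁ lan → B8.Prop5Unique lan →
        B8Thm8Surviving.Thm8SurvivingAt 1 lam.B₁ lam.B₂ (fun j : IdxB8SubC θ => famB8OfRecordSubBP₂C θ lam.β lam.len j) →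
        B8LeafOfRecordSubBP₂C θ (lam.cutSubBP J lan c₁ ρ₀) := by
  obtain ⟨ρ₀, B₁, c₁', hρ₀, -, hB₁, hc₁', P6⟩ := p6_residB8_of_zdCubP θ hD hL5 (t := 1) le_rfl
  refine ⟨ρ₀, B₁, c₁', hρ₀, hB₁, hc₁', fun lam J lan c₁ hB hc l1 t2 p3 t4 p5e p5u t8 => ?_⟩
  have p6 : B8.Prop6Printed θ.D (θ.L : ℝ) lam.B₁ c₁ (fun j : IdxB8SubB θ => zdCubP θ.𝔸 θ.L ρ₀ j.1.1) :=
    P6 (lam.cutSubBP J lan c₁ ρ₀) (fun j : IdxB8SubB θ => j.1.1) rfl hB hc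
  exact b8LeafOfRecordSubBP₂C_of_fields hD (lam.cutSubBP J lan c₁ ρ₀) l1 t2 p3 t4 p5e p5u p6 t8

/-- **… WITH THE BIG BLOCK A MULTIPLE OF ANY GIVEN `t ≥ 1`**: the same seven-binder constructor.
[cite: Balaban1985RegularSpaces, Prop. 6 p.99, p.98 («M is a multiple of R₁M₁»)] -/
theorem b8LeafOfRecordSubBP₂C_cutSubBP_of_fields7_dvd (hD : 2 ≤ θ.D) (hL5 : 5 ≤ θ.L) {t : ℕ} (ht : 1 ≤ t) :
    ∃ ρ₀ : ℕ, ∃ B₁ c₁' : ℝ, 1 ≤ ρ₀ ∧ t ∣ ρ₀ ∧ 0 < B₁ ∧ 0 < c₁' ∧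
      ∀ (lam : ResidB8 θ) (J : Type) (lan : J → B8.LandauData) (c₁ : ℝ), B₁ ≤ lam.B₁ → c₁ ≤ c₁' →
        B8.Lemma1Printed θ.D (blockPairNA θ.D θ.L θ.𝔸) →
        B8.Thm2Printed (fun j : IdxB8SubC θ => (zdGF3P₂ θ.𝔸 θ.L lam.β lam.len j.1.1.1).toGFData) →
        B8.Prop3Printed θ.D (θ.L : ℝ) lam.C₂ lam.inp lam.B₀β (fun j : IdxB8SubC θ => (zdGF3P₂ θ.𝔸 θ.L lam.β lam.len j.1.1.1).toGFData2) →
        B8.Thm4Printed lam.B₁' (fun j : IdxB8SubC θ => (zdGF3P₂ θ.𝔸 θ.L lam.β lam.len j.1.1.1).toGFData) →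
        B8.Prop5Exists lam.inp.B₀' lam.B₁ lan → B8.Prop5Unique lan →
        B8Thm8Surviving.Thm8SurvivingAt 1 lam.B₁ lam.B₂ (fun j : IdxB8SubC θ => famB8OfRecordSubBP₂C θ lam.β lam.len j) →
        B8LeafOfRecordSubBP₂C θ (lam.cutSubBP J lan c₁ ρ₀) := by
  obtain ⟨ρ₀, B₁, c₁', hρ₀, hdvd, hB₁, hc₁', P6⟩ := p6_residB8_of_zdCubP θ hD hL5 ht
  refine ⟨ρ₀, B₁, c₁', hρ₀, hdvd, hB₁, hc₁', fun lam J lan c₁ hB hc l1 t2 p3 t4 p5e p5u t8 => ?_⟩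
  have p6 : B8.Prop6Printed θ.D (θ.L : ℝ) lam.B₁ c₁ (fun j : IdxB8SubB θ => zdCubP θ.𝔸 θ.L ρ₀ j.1.1) :=
    P6 (lam.cutSubBP J lan c₁ ρ₀) (fun j : IdxB8SubB θ => j.1.1) rfl hB hc
  exact b8LeafOfRecordSubBP₂C_of_fields hD (lam.cutSubBP J lan c₁ ρ₀) l1 t2 p3 t4 p5e p5u p6 t8

/-- ★★★ **THE BY-NAME ROAD FOR THE δ₂ KNITS OF RECORD** (k0-s2-w2 g3's threshold-zero device at the «P₂C» slot, `θ.D ≥ 2`, `θ.L ≥ 5`): there are `ρ₀ ≥ 1`, `B₁⋆ > 0`,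
`c₁⋆ > 0` such that for every residual layer `λ` with `B₁⋆ ≤ λ.B₁`, every `J, lan` and every source threshold `c₁`, the «P₂C» slot at dag-n05-d's cut
`B8LeafOfRecordSubBP₂C θ (λ.cutSubB J lan c₁)` — which the δ₂ knits D9b₂C ∕ D9c₂C conclude BY NAME, and at `c₁ := 0` with their `p6` binder FREE
(`B8LeafOfRecordSubBPCutPFields8.prop6Printed_cubB8OfRecord_subB_of_nonpos`) — gives the slot at the print-class cut `B8LeafOfRecordSubBP₂C θ (λ.cutSubBP J lan c₁⋆ ρ₀)`
AT THE GENUINE THRESHOLD `c₁⋆ > 0`, Proposition 6 SUPPLIED by p596570.  No knit re-run, no unbundling.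
[cite: Balaban1985RegularSpaces, Prop. 6 (1.135)–(1.138) p.99, p.98, Thm 2 p.83 («There exist constants B₁, B₂(β₀), c₁»)] -/
theorem b8LeafOfRecordSubBP₂C_cutSubBP_of_cutSubB_any (hD : 2 ≤ θ.D) (hL5 : 5 ≤ θ.L) :
    ∃ ρ₀ : ℕ, ∃ B₁ c₁' : ℝ, 1 ≤ ρ₀ ∧ 0 < B₁ ∧ 0 < c₁' ∧
      ∀ (lam : ResidB8 θ) (J : Type) (lan : J → B8.LandauData) (c₁ : ℝ), B₁ ≤ lam.B₁ →
        B8LeafOfRecordSubBP₂C θ (lam.cutSubB J lan c₁) → B8LeafOfRecordSubBP₂C θ (lam.cutSubBP J lan c₁' ρ₀) := by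
  obtain ⟨ρ₀, B₁, c₁', hρ₀, -, hB₁, hc₁', P6⟩ := p6_residB8_of_zdCubP θ hD hL5 (t := 1) le_rfl
  refine ⟨ρ₀, B₁, c₁', hρ₀, hB₁, hc₁', fun lam J lan c₁ hB h => ?_⟩
  exact b8LeafOfRecordSubBP₂C_cutSubBP_of_cutSubB' lam J lan ρ₀ h
    (P6 (lam.cutSubBP J lan c₁' ρ₀) (fun j : IdxB8SubB θ => j.1.1) rfl hB le_rfl)

end Fields7

#print axioms b8LeafOfRecordSubBP₂C_cutSubBP_of_fields7
#print axioms b8LeafOfRecordSubBP₂C_cutSubBP_of_cutSubB_any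

end Literature.MathematicalPhysics.QuantumFieldTheory.Balaban1983to89.B8LeafOfRecordSubBP2CCutPFields7

end
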